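import Literature.NumberTheory.GaloisRepresentations.NeukirchAbstractUniqueness
import HarnessLib

/-!
# Neukirch's characterisation of decomposition groups, abstract core III: bounded `ℓ`-part of the
# local degree

Topic `NumberTheory/GaloisRepresentations`; namespace
`Literature.NumberTheory.GaloisRepresentations.NeukirchAbstract`.  Proof file: theorems only (no
definition, no instance, no named fact).  Same conventions as `NeukirchAbstractUniqueness.lean` /
`NeukirchAbstractExistence.lean` (one ambient profinite `Γ` acting on a set `P` of "primes" with
stabilisers `D p`, `ℓ`-torsion classes = locally constant `2`-cocycles on subgroups, coboundary
predicate `Cob`).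

In Neukirch's proof ([NSW] Prop. (12.1.9)) the set `S` of places `w` of `L = K̄^{H'}` with
`Br(L_w)(ℓ) ≠ 0` is also the set of places with `ℓ^∞ ∤ [L_w : ℚ_q]`.  The finite-level shadow of
"`ℓ^∞ ∤ [L_w : ℚ_q]`" used here is: the `ℓ`-part of the indices `[D p ∩ V₀ : D p ∩ V]`, `V` running
over the open subgroups between the closed subgroup and `V₀`, is BOUNDED (`Subgroup.relIndex`; no
supernatural numbers, no Sylow theory).  This file proves the two conversions and the transport:

* `exists_bound_of_forall_not_coboundary` — a class surviving at every open level above `C` forces a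
  bounded `ℓ`-part, given (AxLv) "restriction to `D p ∩ W'` kills `H²(D p ∩ W)` when
  `ℓ ∣ [D p ∩ W : D p ∩ W']`" (for `Γ_K`: Serre, *Corps locaux* XIII §3 Prop. 7; the tree's
  `LocalBrauerRestrictionDegree`);
* `exists_level_not_dvd` (argmax) and `exists_surviving_of_bounded` — conversely a bounded `ℓ`-part
  gives, via (AxLn) "`H²(D p ∩ W) ≠ 0`" and (AxLi) "restriction is injective when
  `ℓ ∤ [D p ∩ W : D p ∩ W']`" (cor ∘ res), a local class surviving at every open level;
* `bounded_conj` — transport under `p ↦ g • p`, `C ↦ g C g⁻¹` (`V₀` normal);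
* index bookkeeping `relIndex_inf_ne_zero_of_isOpen`, `relIndex_stabilizer_conj`, `isOpen_map_conj`,
  `map_conj_eq_self_of_normal`, `map_conj_eq_self_of_mem`.

HONEST FRAMING: classical (our kernel check); written for the abc-iut cell's GAP-LEDGER row
G-L4d2g4-1 (campaign L); nothing here bears on [IUTchIII] Cor. 3.12.

## References

* J. Neukirch, *Kennzeichnung der p-adischen und der endlichen algebraischen Zahlkörper*, Invent.
  Math. 6 (1969) 296–314. [Neukirch1969]
* J. Neukirch, A. Schmidt, K. Wingberg, *Cohomology of Number Fields* (2nd ed. 2008), XII §1,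
  Prop. (12.1.9). [NeukirchSchmidtWingberg2008]
* J.-P. Serre, *Corps locaux* (1968), XIII §3. [SerreLocalFields1979]
-/

open Topology
open scoped Pointwise

universe u v w

namespace Literature.NumberTheory.GaloisRepresentations.NeukirchAbstract

open Literature.GroupTheory.LocallyConstantCocycles

variable {Γ : Type u} [Group Γ] [TopologicalSpace Γ]
variable {R : Type v} [Field R]

/-! ### Indices of open subgroups inside a closed subgroup -/

section Index

variable [IsTopologicalGroup Γ] [CompactSpace Γ]

/-- For open subgroups `V ≤ W` of a compact group and any subgroup `D`, the index
`[D ∩ W : D ∩ V]` is finite (non-zero). [cite: NeukirchSchmidtWingberg2008, Prop (12.1.9)] -/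
theorem relIndex_inf_ne_zero_of_isOpen (D : Subgroup Γ) {V W : Subgroup Γ} (hV : IsOpen (V : Set Γ)) :
    (D ⊓ V).relIndex (D ⊓ W) ≠ 0 := by
  haveI : Finite (Γ ⧸ V) := Subgroup.quotient_finite_of_isOpen V hV
  have h1 : V.index ≠ 0 := Subgroup.index_ne_zero_of_finite
  have h2 : V.relIndex W ≠ 0 := by
    intro h
    apply h1
    rw [← Subgroup.relIndex_top_right]
    exact Subgroup.relIndex_eq_zero_of_le_right le_top h
  have h3 := Subgroup.relIndex_inter_ne_zero h2 D
  rwa [inf_comm V D, inf_comm W D] at h3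

omit [TopologicalSpace Γ] [IsTopologicalGroup Γ] [CompactSpace Γ] in
/-- Conjugation preserves the indices `[D p ∩ V₀ : D p ∩ V]` (`V₀` normal):
`[D (g • p) ∩ V₀ : D (g • p) ∩ g V g⁻¹] = [D p ∩ V₀ : D p ∩ V]`. [cite: NeukirchSchmidtWingberg2008, Prop (12.1.9)] -/
theorem relIndex_stabilizer_conj {P : Type w} [MulAction Γ P] {V₀ : Subgroup Γ} [hn : V₀.Normal]
    (g : Γ) (p : P) (V : Subgroup Γ) :
    (MulAction.stabilizer Γ (g • p) ⊓ V.map (MulAut.conj g).toMonoidHom).relIndex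
        (MulAction.stabilizer Γ (g • p) ⊓ V₀) =
      (MulAction.stabilizer Γ p ⊓ V).relIndex (MulAction.stabilizer Γ p ⊓ V₀) := by
  have hinj : Function.Injective (MulAut.conj g).toMonoidHom := (MulAut.conj g).injective
  have hV₀ : V₀.map (MulAut.conj g).toMonoidHom = V₀ := by
    ext x
    rw [Subgroup.mem_map_equiv]
    constructor
    · intro hx
      have := hn.conj_mem _ hx g
      simpa [MulAut.conj_symm_apply, mul_assoc] using this
    · intro hx
      simpa [MulAut.conj_symm_apply] using hn.conj_mem _ hx g⁻¹
  rw [MulAction.stabilizer_smul_eq_stabilizer_map_conj, ← Subgroup.map_inf _ _ _ hinj]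
  conv_lhs => rw [← hV₀, ← Subgroup.map_inf _ _ _ hinj]
  exact Subgroup.relIndex_map_map_of_injective _ _ hinj

omit [CompactSpace Γ] in
/-- The conjugate `g V g⁻¹` of an open subgroup is open. [cite: NeukirchSchmidtWingberg2008, Prop (12.1.9)] -/
theorem isOpen_map_conj {V : Subgroup Γ} (hV : IsOpen (V : Set Γ)) (g : Γ) :
    IsOpen ((V.map (MulAut.conj g).toMonoidHom : Subgroup Γ) : Set Γ) := by
  have : ((V.map (MulAut.conj g).toMonoidHom : Subgroup Γ) : Set Γ) =
      (fun x => g⁻¹ * x * g) ⁻¹' (V : Set Γ) := by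
    ext x
    rw [SetLike.mem_coe, Subgroup.mem_map_equiv, MulAut.conj_symm_apply]
    exact Iff.rfl
  rw [this]
  exact hV.preimage ((continuous_const.mul continuous_id).mul continuous_const)

end Index

/-! ### Bounded `ℓ`-part of the local degree -/

section Bounded

variable [IsTopologicalGroup Γ] [CompactSpace Γ]
variable {P : Type w} [MulAction Γ P] {ℓ : ℕ}
variable (Cob : Subgroup Γ → (Γ → Γ → R) → Prop)

/-- **From a surviving class to bounded `ℓ`-part.**  If a class `y` on an open `V₁ ⊇ C` survives on
`D p ∩ V` for every open `C ≤ V ≤ V₁`, and restriction to `D p ∩ W'` kills `H²(D p ∩ W)` whenever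
`ℓ ∣ [D p ∩ W : D p ∩ W']` (AxLv), then the `ℓ`-part of `[D p ∩ V₀ : D p ∩ V]` is bounded over the
open `C ≤ V ≤ V₀`: "`ℓ^∞ ∤ [L_w : ℚ_q]`" in the proof of [NSW] Prop. (12.1.9).
[cite: NeukirchSchmidtWingberg2008, Prop (12.1.9)] -/
theorem exists_bound_of_forall_not_coboundary (hℓ : ℓ.Prime) {V₀ : Subgroup Γ}
    (AxLv : ∀ (p : P) (W W' : Subgroup Γ), IsOpen (W : Set Γ) → IsOpen (W' : Set Γ) → W ≤ V₀ →
      W' ≤ W → ℓ ∣ (MulAction.stabilizer Γ p ⊓ W').relIndex (MulAction.stabilizer Γ p ⊓ W) →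
      ∀ f : Γ → Γ → R,
        IsLocallyConstant (fun q : ↥(MulAction.stabilizer Γ p ⊓ W) × ↥(MulAction.stabilizer Γ p ⊓ W) =>
          f q.1 q.2) →
        (∀ a ∈ MulAction.stabilizer Γ p ⊓ W, ∀ b ∈ MulAction.stabilizer Γ p ⊓ W,
          ∀ c ∈ MulAction.stabilizer Γ p ⊓ W, f a b + f (a * b) c = f b c + f a (b * c)) →
        Cob (MulAction.stabilizer Γ p ⊓ W') f)
    {C V₁ : Subgroup Γ} (hV₁ : IsOpen (V₁ : Set Γ)) (hCV₁ : C ≤ V₁) (hV₁V₀ : V₁ ≤ V₀) {p : P}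
    {y : Γ → Γ → R} (hylc : IsLocallyConstant (fun q : V₁ × V₁ => y q.1 q.2))
    (hycoc : ∀ a ∈ V₁, ∀ b ∈ V₁, ∀ c ∈ V₁, y a b + y (a * b) c = y b c + y a (b * c))
    (hy : ∀ V : Subgroup Γ, IsOpen (V : Set Γ) → C ≤ V → V ≤ V₁ →
      ¬ Cob (MulAction.stabilizer Γ p ⊓ V) y) :
    ∃ e : ℕ, ∀ V : Subgroup Γ, IsOpen (V : Set Γ) → C ≤ V → V ≤ V₀ →
      ¬ ℓ ^ (e + 1) ∣ (MulAction.stabilizer Γ p ⊓ V).relIndex (MulAction.stabilizer Γ p ⊓ V₀) := by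
  set D := MulAction.stabilizer Γ p with hDdef
  -- `e := [D ∩ V₀ : D ∩ V₁]`, so that `ℓ^(e+1) ∤ [D ∩ V₀ : D ∩ V₁]`
  refine ⟨(D ⊓ V₁).relIndex (D ⊓ V₀), fun V hV hCV hVV₀ hdvd => ?_⟩
  set e := (D ⊓ V₁).relIndex (D ⊓ V₀) with hedef
  have he0 : e ≠ 0 := relIndex_inf_ne_zero_of_isOpen D hV₁
  -- pass to `V ⊓ V₁`
  have hVV₁o : IsOpen ((V ⊓ V₁ : Subgroup Γ) : Set Γ) := hV.inter hV₁
  have hmul : (D ⊓ (V ⊓ V₁)).relIndex (D ⊓ V₀) =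
      (D ⊓ (V ⊓ V₁)).relIndex (D ⊓ V₁) * e :=
    (Subgroup.relIndex_mul_relIndex (D ⊓ (V ⊓ V₁)) (D ⊓ V₁) (D ⊓ V₀)
      (inf_le_inf_left D inf_le_right) (inf_le_inf_left D hV₁V₀)).symm
  have hmul' : (D ⊓ (V ⊓ V₁)).relIndex (D ⊓ V₀) =
      (D ⊓ (V ⊓ V₁)).relIndex (D ⊓ V) * (D ⊓ V).relIndex (D ⊓ V₀) :=
    (Subgroup.relIndex_mul_relIndex (D ⊓ (V ⊓ V₁)) (D ⊓ V) (D ⊓ V₀)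
      (inf_le_inf_left D inf_le_left) (inf_le_inf_left D hVV₀)).symm
  -- `ℓ ∤ [D ∩ V₁ : D ∩ (V ⊓ V₁)]`, since `y` survives there
  have hndvd : ¬ ℓ ∣ (D ⊓ (V ⊓ V₁)).relIndex (D ⊓ V₁) := fun h =>
    hy (V ⊓ V₁) hVV₁o (le_inf hCV hCV₁) inf_le_right
      (AxLv p V₁ (V ⊓ V₁) hV₁ hVV₁o hV₁V₀ inf_le_right h y
        (lc₂_mono inf_le_right hylc) (coc_mono inf_le_right hycoc))
  -- hence `ℓ^(e+1) ∣ [D∩V₀ : D∩(V⊓V₁)] = [D∩V₁ : D∩(V⊓V₁)] · e` forces `ℓ^(e+1) ∣ e`, absurd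
  have h1 : ℓ ^ (e + 1) ∣ (D ⊓ (V ⊓ V₁)).relIndex (D ⊓ V₁) * e := by
    rw [← hmul, hmul']
    exact Dvd.dvd.mul_left hdvd _
  have hcop : Nat.Coprime (ℓ ^ (e + 1)) ((D ⊓ (V ⊓ V₁)).relIndex (D ⊓ V₁)) :=
    Nat.Coprime.pow_left _ ((Nat.Prime.coprime_iff_not_dvd hℓ).2 hndvd)
  have h2 : ℓ ^ (e + 1) ∣ e := hcop.dvd_of_dvd_mul_left h1
  have h3 : ℓ ^ (e + 1) ≤ e := Nat.le_of_dvd (Nat.pos_of_ne_zero he0) h2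
  have h4 : e < ℓ ^ (e + 1) :=
    lt_of_lt_of_le (Nat.lt_succ_self e) (Nat.lt_pow_self hℓ.one_lt).le
  exact absurd h3 (not_le.2 h4)

omit [IsTopologicalGroup Γ] [CompactSpace Γ] in
/-- **Argmax**: a bounded `ℓ`-part yields an open level `V* ⊇ C` below which all the indices
`[D p ∩ V* : D p ∩ V]` (`C ≤ V ≤ V*` open) are prime to `ℓ` (take `V*` realising the largest power of
`ℓ` dividing `[D p ∩ V₀ : D p ∩ V*]`; no Sylow theory needed). [cite: NeukirchSchmidtWingberg2008, Prop (12.1.9)] -/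
theorem exists_level_not_dvd {V₀ : Subgroup Γ} (hV₀ : IsOpen (V₀ : Set Γ)) {C : Subgroup Γ}
    (hCV₀ : C ≤ V₀) {p : P} {e : ℕ}
    (hb : ∀ V : Subgroup Γ, IsOpen (V : Set Γ) → C ≤ V → V ≤ V₀ →
      ¬ ℓ ^ (e + 1) ∣ (MulAction.stabilizer Γ p ⊓ V).relIndex (MulAction.stabilizer Γ p ⊓ V₀)) :
    ∃ Vs : Subgroup Γ, IsOpen (Vs : Set Γ) ∧ C ≤ Vs ∧ Vs ≤ V₀ ∧
      ∀ V : Subgroup Γ, IsOpen (V : Set Γ) → C ≤ V → V ≤ Vs →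
        ¬ ℓ ∣ (MulAction.stabilizer Γ p ⊓ V).relIndex (MulAction.stabilizer Γ p ⊓ Vs) := by
  classical
  set D := MulAction.stabilizer Γ p with hDdef
  -- the set of attained exponents is bounded by `e`
  let K : Set ℕ := {k | ∃ V : Subgroup Γ, IsOpen (V : Set Γ) ∧ C ≤ V ∧ V ≤ V₀ ∧
    ℓ ^ k ∣ (D ⊓ V).relIndex (D ⊓ V₀)}
  have hK0 : 0 ∈ K := ⟨V₀, hV₀, hCV₀, le_rfl, by simp⟩
  have hKbdd : ∀ k ∈ K, k ≤ e := by
    rintro k ⟨V, hV, hCV, hVV₀, hk⟩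
    by_contra hke
    exact hb V hV hCV hVV₀ ((pow_dvd_pow ℓ (by omega)).trans hk)
  have hbdd : BddAbove K := ⟨e, hKbdd⟩
  obtain ⟨Vs, hVs, hCVs, hVsV₀, hks⟩ : sSup K ∈ K := Nat.sSup_mem ⟨0, hK0⟩ hbdd
  refine ⟨Vs, hVs, hCVs, hVsV₀, fun V hV hCV hVVs hdvd => ?_⟩
  -- then `ℓ^(k*+1)` divides `[D∩V₀ : D∩V] = [D∩Vs : D∩V]·[D∩V₀ : D∩Vs]`
  have hmul : (D ⊓ V).relIndex (D ⊓ V₀) = (D ⊓ V).relIndex (D ⊓ Vs) * (D ⊓ Vs).relIndex (D ⊓ V₀) :=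
    (Subgroup.relIndex_mul_relIndex (D ⊓ V) (D ⊓ Vs) (D ⊓ V₀) (inf_le_inf_left D hVVs)
      (inf_le_inf_left D hVsV₀)).symm
  have hmem : sSup K + 1 ∈ K := by
    refine ⟨V, hV, hCV, hVVs.trans hVsV₀, ?_⟩
    rw [hmul, pow_succ']
    exact mul_dvd_mul hdvd hks
  have := le_csSup hbdd hmem
  omega

omit [IsTopologicalGroup Γ] [CompactSpace Γ] in
/-- **From bounded `ℓ`-part back to a surviving local class** (converse direction): given the bound,
(AxLn) at the argmax level `V*` and (AxLi) below it produce a class `f` on `D p ∩ V*` surviving on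
`D p ∩ V` for every open `C ≤ V ≤ V*` — "`ℓ^∞ ∤ [L_w : ℚ_q] ⇒ Br(L_w)(ℓ) ≠ 0`" in [NSW] (12.1.9).
[cite: NeukirchSchmidtWingberg2008, Prop (12.1.9)] -/
theorem exists_surviving_of_bounded {V₀ : Subgroup Γ} (hV₀ : IsOpen (V₀ : Set Γ))
    (AxLn : ∀ (p : P) (W : Subgroup Γ), IsOpen (W : Set Γ) → W ≤ V₀ → ∃ f : Γ → Γ → R,
      IsLocallyConstant (fun q : ↥(MulAction.stabilizer Γ p ⊓ W) × ↥(MulAction.stabilizer Γ p ⊓ W) =>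
        f q.1 q.2) ∧
      (∀ a ∈ MulAction.stabilizer Γ p ⊓ W, ∀ b ∈ MulAction.stabilizer Γ p ⊓ W,
        ∀ c ∈ MulAction.stabilizer Γ p ⊓ W, f a b + f (a * b) c = f b c + f a (b * c)) ∧
      ¬ Cob (MulAction.stabilizer Γ p ⊓ W) f)
    (AxLi : ∀ (p : P) (W W' : Subgroup Γ), IsOpen (W : Set Γ) → IsOpen (W' : Set Γ) → W ≤ V₀ →
      W' ≤ W → ¬ ℓ ∣ (MulAction.stabilizer Γ p ⊓ W').relIndex (MulAction.stabilizer Γ p ⊓ W) →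
      ∀ f : Γ → Γ → R,
        IsLocallyConstant (fun q : ↥(MulAction.stabilizer Γ p ⊓ W) × ↥(MulAction.stabilizer Γ p ⊓ W) =>
          f q.1 q.2) →
        (∀ a ∈ MulAction.stabilizer Γ p ⊓ W, ∀ b ∈ MulAction.stabilizer Γ p ⊓ W,
          ∀ c ∈ MulAction.stabilizer Γ p ⊓ W, f a b + f (a * b) c = f b c + f a (b * c)) →
        Cob (MulAction.stabilizer Γ p ⊓ W') f → Cob (MulAction.stabilizer Γ p ⊓ W) f)
    {C : Subgroup Γ} (hCV₀ : C ≤ V₀) {p : P} {e : ℕ}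
    (hb : ∀ V : Subgroup Γ, IsOpen (V : Set Γ) → C ≤ V → V ≤ V₀ →
      ¬ ℓ ^ (e + 1) ∣ (MulAction.stabilizer Γ p ⊓ V).relIndex (MulAction.stabilizer Γ p ⊓ V₀)) :
    ∃ Vs : Subgroup Γ, IsOpen (Vs : Set Γ) ∧ C ≤ Vs ∧ Vs ≤ V₀ ∧ ∃ f : Γ → Γ → R,
      IsLocallyConstant (fun q : ↥(MulAction.stabilizer Γ p ⊓ Vs) × ↥(MulAction.stabilizer Γ p ⊓ Vs) =>
        f q.1 q.2) ∧
      (∀ a ∈ MulAction.stabilizer Γ p ⊓ Vs, ∀ b ∈ MulAction.stabilizer Γ p ⊓ Vs,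
        ∀ c ∈ MulAction.stabilizer Γ p ⊓ Vs, f a b + f (a * b) c = f b c + f a (b * c)) ∧
      ∀ V : Subgroup Γ, IsOpen (V : Set Γ) → C ≤ V → V ≤ Vs →
        ¬ Cob (MulAction.stabilizer Γ p ⊓ V) f := by
  obtain ⟨Vs, hVs, hCVs, hVsV₀, hnd⟩ := exists_level_not_dvd hV₀ hCV₀ hb
  obtain ⟨f, hflc, hfcoc, hf⟩ := AxLn p Vs hVs hVsV₀
  exact ⟨Vs, hVs, hCVs, hVsV₀, f, hflc, hfcoc, fun V hV hCV hVVs hfV =>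
    hf (AxLi p Vs V hVs hV hVsV₀ hVVs (hnd V hV hCV hVVs) f hflc hfcoc hfV)⟩

end Bounded

/-! ### Conjugation -/

section Conj

variable {P : Type w} [MulAction Γ P] {ℓ : ℕ}

omit [TopologicalSpace Γ] in
/-- An open normal... rather: any normal subgroup is fixed by conjugation: `g N g⁻¹ = N`.
[cite: NeukirchSchmidtWingberg2008, Prop (12.1.9)] -/
theorem map_conj_eq_self_of_normal {N : Subgroup Γ} [hn : N.Normal] (g : Γ) :
    N.map (MulAut.conj g).toMonoidHom = N := by
  ext x
  rw [Subgroup.mem_map_equiv]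
  constructor
  · intro hx
    have := hn.conj_mem _ hx g
    simpa [MulAut.conj_symm_apply, mul_assoc] using this
  · intro hx
    simpa [MulAut.conj_symm_apply] using hn.conj_mem _ hx g⁻¹

omit [TopologicalSpace Γ] in
/-- A subgroup is fixed by conjugation by its own elements. [cite: NeukirchSchmidtWingberg2008, Prop (12.1.9)] -/
theorem map_conj_eq_self_of_mem {H : Subgroup Γ} {h : Γ} (hh : h ∈ H) :
    H.map (MulAut.conj h).toMonoidHom = H := by
  ext x
  rw [Subgroup.mem_map_equiv, MulAut.conj_symm_apply]
  constructor
  · intro hx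
    have := H.mul_mem (H.mul_mem hh hx) (H.inv_mem hh)
    simpa [mul_assoc] using this
  · intro hx
    exact H.mul_mem (H.mul_mem (H.inv_mem hh) hx) hh

variable [IsTopologicalGroup Γ]

/-- **Conjugation transport of the bounded-`ℓ`-part property** (`V₀` normal): if the `ℓ`-part of
`[D p ∩ V₀ : D p ∩ V]` is bounded by `ℓ^e` over the open `C ≤ V ≤ V₀`, then so is that of
`[D (g • p) ∩ V₀ : D (g • p) ∩ V]` over the open `g C g⁻¹ ≤ V ≤ V₀`.
[cite: NeukirchSchmidtWingberg2008, Prop (12.1.9)] -/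
theorem bounded_conj {V₀ : Subgroup Γ} [V₀.Normal] {C : Subgroup Γ} {p : P} {e : ℕ}
    (hb : ∀ V : Subgroup Γ, IsOpen (V : Set Γ) → C ≤ V → V ≤ V₀ →
      ¬ ℓ ^ (e + 1) ∣ (MulAction.stabilizer Γ p ⊓ V).relIndex (MulAction.stabilizer Γ p ⊓ V₀))
    (g : Γ) :
    ∀ V : Subgroup Γ, IsOpen (V : Set Γ) → C.map (MulAut.conj g).toMonoidHom ≤ V → V ≤ V₀ →
      ¬ ℓ ^ (e + 1) ∣ (MulAction.stabilizer Γ (g • p) ⊓ V).relIndex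
        (MulAction.stabilizer Γ (g • p) ⊓ V₀) := by
  intro V hV hCV hVV₀
  set V' : Subgroup Γ := V.map (MulAut.conj g⁻¹).toMonoidHom with hV'def
  have hmemV' : ∀ x, x ∈ V' ↔ g * x * g⁻¹ ∈ V := fun x => by
    rw [hV'def, Subgroup.mem_map_equiv, MulAut.conj_symm_apply, inv_inv]
  have hVeq : V'.map (MulAut.conj g).toMonoidHom = V := by
    ext x
    rw [Subgroup.mem_map_equiv, MulAut.conj_symm_apply, hmemV']
    have : g * (g⁻¹ * x * g) * g⁻¹ = x := by group
    rw [this]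
  have hV'o : IsOpen (V' : Set Γ) := isOpen_map_conj hV g⁻¹
  have hCV' : C ≤ V' := fun c hc => (hmemV' c).2 (hCV (Subgroup.mem_map_of_mem _ hc))
  have hV'V₀ : V' ≤ V₀ := fun x hx => by
    have h1 : g * x * g⁻¹ ∈ V₀ := hVV₀ ((hmemV' x).1 hx)
    have h2 := ‹V₀.Normal›.conj_mem _ h1 g⁻¹
    simpa [mul_assoc] using h2
  have key := relIndex_stabilizer_conj (V₀ := V₀) g p V'
  rw [hVeq] at key
  rw [key]
  exact hb V' hV'o hCV' hV'V₀

end Conj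

end Literature.NumberTheory.GaloisRepresentations.NeukirchAbstract
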